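import Literature.MathematicalPhysics.KineticTheory.TruncatedPicardFunctionals
import Literature.MathematicalPhysics.KineticTheory.CollisionLineBound
import HarnessLib

/-!
# The truncated collision functionals: the line bound and the level-`n` estimates

Topic: MathematicalPhysics / KineticTheory. Continuation of `TruncatedPicardFunctionals`
(infrastructure for CIP 1994 §5.3 Lemma 5.3.6, the truncated problems of the DiPerna–Lions
scheme): the two estimates on the source `Γ = (1 + δ∫g)⁻¹ Q⁺_B(g,g)` and the absorption
`Λ = (1 + δ∫g)⁻¹ (A ∗ g)` of a nonnegative Schwartz-type slice `g` that make the Picard iteration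
close *globally in time* and *without loss of derivatives or weights*:

* `TruncPicard.source_le_line` (**CIP (3.19)**, the linear sup bound): for a kernel vanishing
  near grazing collisions, `Γ(z) ≤ C_line δ⁻¹ sup g`, with
  `C_line = 2 M (2R₊)^{d-1} δ^{1-d}` from the line bound
  `Literature.MathematicalPhysics.KineticTheory.lintegral_kernel_gain_line_le` and the
  normalisation `(1 + δ m)⁻¹ m ≤ δ⁻¹` — the only place where the grazing cut-off is used;
* `TruncPicard.weight_mul_norm_iteratedFDeriv_mul_le_ends`: Leibniz for a product with the two
  extreme orders kept apart (the weight on the second factor);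
* `TruncPicard.absorption_level_bound`, `TruncPicard.source_level_bound` (**the level-`n`
  estimates**): for `n ≥ 1` and a weight `k ≥ d + 1` there are constants `c₁, c₂`, depending only
  on `n, k, δ`, the kernel mass and a bound `L` for the weighted derivatives of orders `< n` of
  `g`, such that `(1 + ‖z‖)ᵏ ‖DⁿΓ(z)‖ ≤ c₁ T + c₂` and `‖DⁿΛ(z)‖ ≤ c₁ T + c₂` whenever
  `(1 + ‖y‖)ᵏ ‖Dⁿg(y)‖ ≤ T` — *affine in the top order*, uniformly over all such `g`;
* `TruncPicard.source_bounds_all`, `TruncPicard.absorption_bounds_all`: all weighted derivatives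
  of `Γ`, `Λ` are bounded for a Schwartz-type slice.

Everything is proved; theorems only.

## References

* C. Cercignani, R. Illner, M. Pulvirenti, *The Mathematical Theory of Dilute Gases*, Springer
  (1994), §5.3 (3.18)–(3.20) and Lemma 5.3.6, pp. 145–146.
-/

open MeasureTheory Metric Real Set Filter Function
open scoped InnerProductSpace ENNReal ContDiff Topology

noncomputable section

namespace Literature.MathematicalPhysics.KineticTheory

open Literature.Analysis.Calculus Literature.Analysis.FluidPDE

variable {E : Type*} [NormedAddCommGroup E] [InnerProductSpace ℝ E] [FiniteDimensional ℝ E]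
  [MeasurableSpace E] [BorelSpace E]

namespace TruncPicard

variable {B : E × E → sphere (0 : E) 1 → ℝ} {M R : ℝ} {g : E × E → ℝ} {C : ℕ → ℕ → ℝ} {δ : ℝ}

/-! ## The line bound (CIP (3.19)) -/

omit [FiniteDimensional ℝ E] [MeasurableSpace E] [BorelSpace E] in
/-- `z + shift₁ q = (x, v - ⟨u,ω⟩ω)`. [folklore] -/
theorem add_shift₁ (z : E × E) (q : E × sphere (0 : E) 1) :
    z + shift₁ q = (z.1, z.2 - ⟪q.1, (q.2 : E)⟫_ℝ • (q.2 : E)) :=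
  Prod.ext (by simp [shift₁]) (by simp [shift₁, sub_eq_add_neg])

/-- The first-factor integral of the gain term obeys the line bound:
`∫∫ B(u, ω) g(x, v - ⟨u,ω⟩ω) du dω ≤ C_line ∫ g(x, w) dw`, `C_line = 2 M (2 R₊)^{d-1} δ^{1-d}`,
for a nonnegative continuous slice and a kernel vanishing near grazing collisions
(`E` nontrivial). [cite: CIPDiluteGases1994, §5.3 (3.19) (pp. 145–146)] -/
theorem integral_kernel_mul_shift₁_le_line [Nontrivial E] (h : KernelHyp B M R) (hδ : 0 < δ)
    (hgraz : ∀ (z : E) (om : sphere (0 : E) 1), |⟪z, (om : E)⟫_ℝ| < δ → B (z, 0) om = 0)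
    (hgc : Continuous g) (hg0 : ∀ z, 0 ≤ g z) {K₀ : ℝ} (hK₀ : ∀ z, g z ≤ K₀) (z : E × E)
    (hint : Integrable (fun w : E => g (z.1, w)) volume) :
    ∫ q, B (q.1, 0) q.2 * g (z + shift₁ q) ∂(kernelMeasure E) ≤
      (M * (2 * max R 0) ^ (Module.finrank ℝ E - 1) * (2 * (δ ^ (Module.finrank ℝ E - 1))⁻¹)) * mass g z := by
  haveI := isFiniteMeasure_sphereMeasure (E := E)
  set Cl : ℝ := M * (2 * max R 0) ^ (Module.finrank ℝ E - 1) * (2 * (δ ^ (Module.finrank ℝ E - 1))⁻¹) with hCl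
  have hCl0 : 0 ≤ Cl := by rw [hCl]; exact mul_nonneg (mul_nonneg h.bound_nonneg (by positivity)) (by positivity)
  -- the Bochner integral as a lower Lebesgue integral
  set F : E × sphere (0 : E) 1 → ℝ := fun q => B (q.1, 0) q.2 * g (z + shift₁ q) with hF
  have hF0 : ∀ q, 0 ≤ F q := fun q => mul_nonneg (h.nonneg _ _) (hg0 _)
  have hFi : Integrable F (kernelMeasure E) :=
    h.integrable_mul ((hgc.comp (continuous_const.add continuous_shift₁)).aestronglyMeasurable)
      (K := K₀) fun q => by rw [Real.norm_of_nonneg (hg0 _)]; exact hK₀ _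
  have h1 : ENNReal.ofReal (∫ q, F q ∂(kernelMeasure E)) = ∫⁻ q, ENNReal.ofReal (F q) ∂(kernelMeasure E) :=
    ofReal_integral_eq_lintegral_ofReal hFi (Eventually.of_forall hF0)
  -- Tonelli in the order `dω du` and the line bound
  set b : E × sphere (0 : E) 1 → ℝ≥0∞ := fun q => ENNReal.ofReal (B (q.1, 0) q.2) with hb
  set gx : E → ℝ≥0∞ := fun w => ENNReal.ofReal (g (z.1, w)) with hgx
  have hgxm : Measurable gx := ENNReal.measurable_ofReal.comp (hgc.measurable.comp
    (measurable_const.prodMk measurable_id))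
  have hprod : ∀ q, ENNReal.ofReal (F q) = b q * gx (z.2 - ⟪q.1, (q.2 : E)⟫_ℝ • (q.2 : E)) := by
    intro q
    simp only [hF, hb, hgx, add_shift₁]
    rw [ENNReal.ofReal_mul (h.nonneg _ _)]
  have hmeas : Measurable fun q : E × sphere (0 : E) 1 => b q * gx (z.2 - ⟪q.1, (q.2 : E)⟫_ℝ • (q.2 : E)) :=
    (ENNReal.measurable_ofReal.comp h.measurable_kernel).mul
      (hgxm.comp (measurable_const.sub ((measurable_fst.inner (measurable_subtype_coe.comp
        measurable_snd)).smul (measurable_subtype_coe.comp measurable_snd))))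
  have h2 : ∫⁻ q, ENNReal.ofReal (F q) ∂(kernelMeasure E) =
      ∫⁻ om, ∫⁻ u, b (u, om) * gx (z.2 - ⟪u, (om : E)⟫_ℝ • (om : E)) ∂volume ∂sphereMeasure := by
    simp_rw [hprod]
    exact lintegral_prod_symm' _ hmeas
  have hline := lintegral_kernel_gain_line_le (b := b) (M := ENNReal.ofReal M) (R := max R 0)
    ENNReal.ofReal_ne_top (fun q => ENNReal.ofReal_le_ofReal (h.le _ _)) hδ
    (fun q hq => by
      simp only [hb]
      rw [h.eq_zero _ _ ((le_max_left _ _).trans hq.le), ENNReal.ofReal_zero])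
    (fun q hq => by simp only [hb]; rw [hgraz _ _ hq, ENNReal.ofReal_zero]) hgxm z.2
  -- the mass as a lower Lebesgue integral
  have hmass : ∫⁻ w, gx w = ENNReal.ofReal (mass g z) := by
    rw [mass, ofReal_integral_eq_lintegral_ofReal hint (Eventually.of_forall fun w => hg0 _)]
  have hconst : ENNReal.ofReal M * ENNReal.ofReal (2 * max R 0) ^ (Module.finrank ℝ E - 1) *
      (2 * ENNReal.ofReal ((δ ^ (Module.finrank ℝ E - 1))⁻¹)) = ENNReal.ofReal Cl := by
    rw [hCl, ← ENNReal.ofReal_pow (by positivity), ← ENNReal.ofReal_mul h.bound_nonneg,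
      show (2 : ℝ≥0∞) = ENNReal.ofReal 2 by simp, ← ENNReal.ofReal_mul (by norm_num),
      ← ENNReal.ofReal_mul (mul_nonneg h.bound_nonneg (by positivity))]
  have hfin : ENNReal.ofReal (∫ q, F q ∂(kernelMeasure E)) ≤ ENNReal.ofReal (Cl * mass g z) := by
    rw [h1, h2]
    refine hline.trans (le_of_eq ?_)
    rw [hmass, hconst, ← ENNReal.ofReal_mul hCl0]
  exact (ENNReal.ofReal_le_ofReal_iff (mul_nonneg hCl0 (mass_nonneg hg0 z))).1 hfin

/-- **The linear sup bound for the source (CIP (3.19))**: for a kernel vanishing near grazing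
collisions and a nonnegative Schwartz-type slice with `g ≤ C₀`,
`Γ(z) = (1 + δ ∫g)⁻¹ Q⁺_B(g,g)(z) ≤ C_line δ⁻¹ C₀` — the second factor is bounded by `C₀`, the
first integrated by the line bound against the local mass, which the normalisation cancels. This
is the estimate that makes the truncated problem globally solvable. [cite: CIPDiluteGases1994, §5.3 (3.19) (pp. 145–146)] -/
theorem source_le_line (h : KernelHyp B M R) (hδ : 0 < δ)
    (hgraz : ∀ (z : E) (om : sphere (0 : E) 1), |⟪z, (om : E)⟫_ℝ| < δ → B (z, 0) om = 0)
    (hg : ContDiff ℝ ∞ g) (hg0 : ∀ z, 0 ≤ g z)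
    (hC : ∀ (n k : ℕ) (z : E × E), (1 + ‖z‖) ^ k * ‖iteratedFDeriv ℝ n g z‖ ≤ C n k)
    {C₀ : ℝ} (h0 : ∀ y, g y ≤ C₀) (z : E × E) :
    source δ B g z ≤ (M * (2 * max R 0) ^ (Module.finrank ℝ E - 1) *
      (2 * (δ ^ (Module.finrank ℝ E - 1))⁻¹)) * δ⁻¹ * C₀ := by
  set Cl : ℝ := M * (2 * max R 0) ^ (Module.finrank ℝ E - 1) * (2 * (δ ^ (Module.finrank ℝ E - 1))⁻¹) with hCl
  have hCl0 : 0 ≤ Cl := by rw [hCl]; exact mul_nonneg (mul_nonneg h.bound_nonneg (by positivity)) (by positivity)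
  have hC0 : 0 ≤ C₀ := (hg0 0).trans (h0 0)
  obtain ⟨hNpos, hNle⟩ := normFactor_pos_le_one hδ.le hg0 z
  rcases subsingleton_or_nontrivial E with hE | hE
  · -- `E` trivial: the sphere is empty and the gain term vanishes
    haveI := hE
    have hempty : IsEmpty (sphere (0 : E) 1) := by
      refine ⟨fun om => ?_⟩
      have h1 : ‖(om : E)‖ = 1 := norm_eq_of_mem_sphere om
      rw [Subsingleton.elim (om : E) 0, norm_zero] at h1
      exact zero_ne_one h1
    have hμ : (kernelMeasure E) = 0 := by
      rw [kernelMeasure, show (sphereMeasure : Measure (sphere (0 : E) 1)) = 0 from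
        Measure.eq_zero_of_isEmpty _, Measure.prod_zero]
    have hgain : gain B g z = 0 := by rw [gain, hμ, integral_zero_measure]
    rw [source, hgain, mul_zero]
    positivity
  · haveI := hE
    -- bound the second factor by `C₀`, integrate the first by the line bound
    have hgain : gain B g z ≤ C₀ * (Cl * mass g z) := by
      have hpt : ∀ q : E × sphere (0 : E) 1, B (q.1, 0) q.2 * (g (z + shift₁ q) * g (z + shift₂ q)) ≤
          C₀ * (B (q.1, 0) q.2 * g (z + shift₁ q)) := fun q => by
        have := h0 (z + shift₂ q)
        have h1 := hg0 (z + shift₁ q)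
        have h2 := h.nonneg (q.1, 0) q.2
        nlinarith [mul_nonneg h2 h1]
      have hi1 : Integrable (fun q : E × sphere (0 : E) 1 => B (q.1, 0) q.2 * (g (z + shift₁ q) * g (z + shift₂ q)))
          (kernelMeasure E) :=
        h.integrable_mul (((hg.continuous.comp (continuous_const.add continuous_shift₁)).mul
          (hg.continuous.comp (continuous_const.add continuous_shift₂))).aestronglyMeasurable) (K := C₀ * C₀)
          fun q => by
            rw [Real.norm_of_nonneg (mul_nonneg (hg0 _) (hg0 _))]
            exact mul_le_mul (h0 _) (h0 _) (hg0 _) hC0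
      have hi2 : Integrable (fun q : E × sphere (0 : E) 1 => B (q.1, 0) q.2 * g (z + shift₁ q)) (kernelMeasure E) :=
        h.integrable_mul ((hg.continuous.comp (continuous_const.add continuous_shift₁)).aestronglyMeasurable)
          (K := C₀) fun q => by rw [Real.norm_of_nonneg (hg0 _)]; exact h0 _
      calc gain B g z ≤ ∫ q, C₀ * (B (q.1, 0) q.2 * g (z + shift₁ q)) ∂(kernelMeasure E) :=
            integral_mono hi1 (hi2.const_mul C₀) hpt
        _ = C₀ * ∫ q, B (q.1, 0) q.2 * g (z + shift₁ q) ∂(kernelMeasure E) := integral_const_mul _ _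
        _ ≤ C₀ * (Cl * mass g z) := mul_le_mul_of_nonneg_left
            (integral_kernel_mul_shift₁_le_line h hδ hgraz hg.continuous hg0 h0 z
              (integrable_mass_integrand hg hC z.1)) hC0
    have hNm : normFactor δ g z * mass g z ≤ δ⁻¹ := by
      have h1 := normFactor_mul_mass_le hδ.le hg0 z
      have hδ0 : δ ≠ 0 := hδ.ne'
      have e : normFactor δ g z * mass g z = (normFactor δ g z * (δ * mass g z)) * δ⁻¹ := by
        field_simp
      rw [e]
      calc normFactor δ g z * (δ * mass g z) * δ⁻¹ ≤ 1 * δ⁻¹ :=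
            mul_le_mul_of_nonneg_right h1 (inv_nonneg.2 hδ.le)
        _ = δ⁻¹ := one_mul _
    calc source δ B g z = normFactor δ g z * gain B g z := rfl
      _ ≤ normFactor δ g z * (C₀ * (Cl * mass g z)) := mul_le_mul_of_nonneg_left hgain hNpos.le
      _ = Cl * C₀ * (normFactor δ g z * mass g z) := by ring
      _ ≤ Cl * C₀ * δ⁻¹ := mul_le_mul_of_nonneg_left hNm (mul_nonneg hCl0 hC0)
      _ = Cl * δ⁻¹ * C₀ := by ring

/-! ## Leibniz with the extreme orders separated -/

omit [FiniteDimensional ℝ E] [MeasurableSpace E] [BorelSpace E] in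
/-- **Leibniz for a product, the two extreme orders kept apart**, the weight carried by the
second factor: if `‖D⁰N‖ ≤ x₀`, `‖DⁿN‖ ≤ xₙ`, `‖DⁱN‖ ≤ X` (`1 ≤ i < n`) and
`(1+‖z‖)ᵏ ‖D⁰G‖ ≤ y₀`, `(1+‖z‖)ᵏ ‖DⁿG‖ ≤ yₙ`, `(1+‖z‖)ᵏ ‖DʲG‖ ≤ Y` (`1 ≤ j < n`) at `z`, then
`(1+‖z‖)ᵏ ‖Dⁿ(N G)(z)‖ ≤ x₀ yₙ + xₙ y₀ + 2ⁿ X Y`. [folklore] -/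
theorem weight_mul_norm_iteratedFDeriv_mul_le_ends {N G : E × E → ℝ} (hN : ContDiff ℝ ∞ N)
    (hG : ContDiff ℝ ∞ G) {n k : ℕ} {z : E × E} {x₀ xₙ X y₀ yₙ Y : ℝ} (hX : 0 ≤ X) (hY : 0 ≤ Y)
    (hx₀ : ‖iteratedFDeriv ℝ 0 N z‖ ≤ x₀) (hxₙ : ‖iteratedFDeriv ℝ n N z‖ ≤ xₙ)
    (hxm : ∀ i, 1 ≤ i → i < n → ‖iteratedFDeriv ℝ i N z‖ ≤ X)
    (hy₀ : (1 + ‖z‖) ^ k * ‖iteratedFDeriv ℝ 0 G z‖ ≤ y₀)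
    (hyₙ : (1 + ‖z‖) ^ k * ‖iteratedFDeriv ℝ n G z‖ ≤ yₙ)
    (hym : ∀ j, 1 ≤ j → j < n → (1 + ‖z‖) ^ k * ‖iteratedFDeriv ℝ j G z‖ ≤ Y) :
    (1 + ‖z‖) ^ k * ‖iteratedFDeriv ℝ n (fun z => N z * G z) z‖ ≤ x₀ * yₙ + xₙ * y₀ + 2 ^ n * X * Y := by
  have hw0 : 0 < (1 + ‖z‖) ^ k := by positivity
  have hLeib := norm_iteratedFDeriv_mul_le hN hG z (n := n) (mod_cast le_top)
  calc (1 + ‖z‖) ^ k * ‖iteratedFDeriv ℝ n (fun z => N z * G z) z‖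
      ≤ (1 + ‖z‖) ^ k * ∑ i ∈ Finset.range (n + 1), (n.choose i : ℝ) * ‖iteratedFDeriv ℝ i N z‖ *
          ‖iteratedFDeriv ℝ (n - i) G z‖ := mul_le_mul_of_nonneg_left hLeib hw0.le
    _ = ∑ i ∈ Finset.range (n + 1), (n.choose i : ℝ) * ‖iteratedFDeriv ℝ i N z‖ *
          ((1 + ‖z‖) ^ k * ‖iteratedFDeriv ℝ (n - i) G z‖) := by
        rw [Finset.mul_sum]
        exact Finset.sum_congr rfl fun i _ => by ring
    _ ≤ ‖iteratedFDeriv ℝ 0 N z‖ * ((1 + ‖z‖) ^ k * ‖iteratedFDeriv ℝ n G z‖) +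
          ‖iteratedFDeriv ℝ n N z‖ * ((1 + ‖z‖) ^ k * ‖iteratedFDeriv ℝ 0 G z‖) + 2 ^ n * X * Y :=
        sum_choose_mul_le_ends (x := fun i => ‖iteratedFDeriv ℝ i N z‖)
          (y := fun j => (1 + ‖z‖) ^ k * ‖iteratedFDeriv ℝ j G z‖) (fun i _ => norm_nonneg _)
          (fun j _ => by positivity) hX hY hxm hym
    _ ≤ x₀ * yₙ + xₙ * y₀ + 2 ^ n * X * Y := by
        have h1 := mul_le_mul hx₀ hyₙ (by positivity) ((norm_nonneg _).trans hx₀)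
        have h2 := mul_le_mul hxₙ hy₀ (by positivity) ((norm_nonneg _).trans hxₙ)
        linarith

/-! ## The level-`n` estimates -/

/-- The velocity weight `J_d = ∫ (1 + ‖w‖)^{-(d+1)} dw ≥ 0`. [folklore] -/
theorem weightInv_integral_nonneg : 0 ≤ ∫ w : E, (1 + ‖w‖) ^ (-((Module.finrank ℝ E : ℝ) + 1)) :=
  integral_nonneg fun w => Real.rpow_nonneg (by positivity) _

/-- **The derivatives of the normalising factor**: for `n ≥ 1` and `k ≥ d + 1`, if
`(1 + ‖y‖)ᵏ ‖Dⁱg(y)‖ ≤ L` for `i < n` and `≤ T` for `i = n`, then at every `z`: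
`‖Dⁱ(1 + δ mass g)⁻¹(z)‖ ≤ Θ^(2^(n-1) - 1)` for `i ≤ n - 1` and
`‖Dⁿ(1 + δ mass g)⁻¹(z)‖ ≤ δ J_d T + κ`, with `Θ = 4ⁿ⁻¹ max(δ,1) S`, `S = max 1 (J_d L)`,
`κ = 2ⁿ⁻¹ δ 2ⁿ⁻¹ Θ^(2ⁿ⁻¹-1) Θ^(2ⁿ⁻¹-1) S` depending on the lower orders only. [folklore] -/
theorem normFactor_level_bound (hδ : 0 ≤ δ) (hg : ContDiff ℝ ∞ g) (hg0 : ∀ z, 0 ≤ g z)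
    (hC : ∀ (n k : ℕ) (z : E × E), (1 + ‖z‖) ^ k * ‖iteratedFDeriv ℝ n g z‖ ≤ C n k)
    {n : ℕ} (hn : 1 ≤ n) {k : ℕ} (hk : Module.finrank ℝ E + 1 ≤ k) {L T : ℝ}
    (hL : ∀ i < n, ∀ y : E × E, (1 + ‖y‖) ^ k * ‖iteratedFDeriv ℝ i g y‖ ≤ L)
    (hT : ∀ y : E × E, (1 + ‖y‖) ^ k * ‖iteratedFDeriv ℝ n g y‖ ≤ T) (z : E × E) :
    (∀ i ≤ n - 1, ‖iteratedFDeriv ℝ i (normFactor δ g) z‖ ≤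
      (4 ^ (n - 1) * max δ 1 * max 1 ((∫ w : E, (1 + ‖w‖) ^ (-((Module.finrank ℝ E : ℝ) + 1))) * L)) ^
        (2 ^ (n - 1) - 1)) ∧
    ‖iteratedFDeriv ℝ n (normFactor δ g) z‖ ≤
      δ * ((∫ w : E, (1 + ‖w‖) ^ (-((Module.finrank ℝ E : ℝ) + 1))) * T) +
        2 ^ (n - 1) * (δ * (2 ^ (n - 1) *
          (4 ^ (n - 1) * max δ 1 * max 1 ((∫ w : E, (1 + ‖w‖) ^ (-((Module.finrank ℝ E : ℝ) + 1))) * L)) ^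
            (2 ^ (n - 1) - 1) *
          (4 ^ (n - 1) * max δ 1 * max 1 ((∫ w : E, (1 + ‖w‖) ^ (-((Module.finrank ℝ E : ℝ) + 1))) * L)) ^
            (2 ^ (n - 1) - 1)) * max 1 ((∫ w : E, (1 + ‖w‖) ^ (-((Module.finrank ℝ E : ℝ) + 1))) * L)) := by
  set Jd : ℝ := ∫ w : E, (1 + ‖w‖) ^ (-((Module.finrank ℝ E : ℝ) + 1)) with hJd
  have hJd0 : 0 ≤ Jd := weightInv_integral_nonneg
  set S : ℝ := max 1 (Jd * L) with hS
  have hS1 : 1 ≤ S := le_max_left _ _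
  obtain ⟨n', rfl⟩ : ∃ n', n = n' + 1 := ⟨n - 1, (Nat.sub_add_cancel hn).symm⟩
  simp only [Nat.add_sub_cancel]
  have hm := contDiff_mass hg hC
  have hm0 := mass_nonneg hg0
  -- mass derivative bounds: `‖Dˡ mass‖ ≤ J_d L` for `l ≤ n'`, `‖D^{n'+1} mass‖ ≤ J_d T`
  have hml : ∀ l, 1 ≤ l → l ≤ n' → ‖iteratedFDeriv ℝ l (mass g) z‖ ≤ S := by
    intro l _ hl
    refine (norm_iteratedFDeriv_mass_le hg hC (fun y => weight_mono hk (hL l (Nat.lt_succ_of_le hl)) y) z).trans ?_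
    exact le_max_right _ _
  have hmt : ‖iteratedFDeriv ℝ (n' + 1) (mass g) z‖ ≤ Jd * T :=
    norm_iteratedFDeriv_mass_le hg hC (fun y => weight_mono hk hT y) z
  refine ⟨fun i hi => ?_, ?_⟩
  · have h := norm_iteratedFDeriv_inv_one_add_le hm hδ hm0 (z := z) hS1 hml i hi
    refine h.trans (pow_le_pow_right₀ ?_ (Nat.sub_le_sub_right (Nat.pow_le_pow_right (by norm_num) hi) 1))
    exact one_le_mul_of_one_le_of_one_le (one_le_mul_of_one_le_of_one_le (one_le_pow₀ (by norm_num))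
      (le_max_right _ _)) hS1
  · exact norm_iteratedFDeriv_inv_one_add_succ_le hm hδ hm0 hS1 hml hmt

/-- **The level-`n` estimate for the absorption `Λ = (1 + δ∫g)⁻¹ (A ∗ g)`**: for `n ≥ 1`,
`k ≥ d + 1` and `L ≥ 0` there are `c₁, c₂ ≥ 0` (depending on `n, k, δ, ‖B‖₁, J_d, L` only) such that
for every nonnegative Schwartz-type slice with `(1 + ‖y‖)ᵏ ‖Dⁱg(y)‖ ≤ L` (`i < n`) and
`(1 + ‖y‖)ᵏ ‖Dⁿg(y)‖ ≤ T`: `‖DⁿΛ(z)‖ ≤ c₁ T + c₂` for all `z`. [cite: CIPDiluteGases1994, §5.3 Lemma 5.3.6 (p. 146)] -/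
theorem absorption_level_bound (h : KernelHyp B M R) (hδ : 0 ≤ δ) {n : ℕ} (hn : 1 ≤ n) {k : ℕ}
    (hk : Module.finrank ℝ E + 1 ≤ k) {L : ℝ} (hL0 : 0 ≤ L) :
    ∃ c₁ c₂ : ℝ, 0 ≤ c₁ ∧ 0 ≤ c₂ ∧ ∀ (g : E × E → ℝ) (C : ℕ → ℕ → ℝ) (T : ℝ),
      ContDiff ℝ ∞ g → (∀ z, 0 ≤ g z) →
      (∀ (m k' : ℕ) (z : E × E), (1 + ‖z‖) ^ k' * ‖iteratedFDeriv ℝ m g z‖ ≤ C m k') →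
      (∀ i < n, ∀ y : E × E, (1 + ‖y‖) ^ k * ‖iteratedFDeriv ℝ i g y‖ ≤ L) →
      (∀ y : E × E, (1 + ‖y‖) ^ k * ‖iteratedFDeriv ℝ n g y‖ ≤ T) →
      ∀ z, ‖iteratedFDeriv ℝ n (absorption δ B g) z‖ ≤ c₁ * T + c₂ := by
  set Jd : ℝ := ∫ w : E, (1 + ‖w‖) ^ (-((Module.finrank ℝ E : ℝ) + 1)) with hJd
  have hJd0 : 0 ≤ Jd := weightInv_integral_nonneg
  set S : ℝ := max 1 (Jd * L) with hS
  set Θ : ℝ := (4 ^ (n - 1) * max δ 1 * S) ^ (2 ^ (n - 1) - 1) with hΘ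
  have hΘ0 : 0 ≤ Θ := by positivity
  set κ : ℝ := 2 ^ (n - 1) * (δ * (2 ^ (n - 1) * Θ * Θ) * S) with hκ
  have hκ0 : 0 ≤ κ := by positivity
  have hKM := h.kernelMass_nonneg
  refine ⟨kernelMass B + δ * Jd * (kernelMass B * L), κ * (kernelMass B * L) + 2 ^ n * Θ * (kernelMass B * L),
    by positivity, by positivity, ?_⟩
  intro g C T hg hg0 hC hL hT z
  have hT0 : 0 ≤ T := le_trans (by positivity) (hT 0)
  obtain ⟨hNmid, hNtop⟩ := normFactor_level_bound hδ hg hg0 hC hn hk hL hT z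
  have hN := contDiff_normFactor hδ hg hg0 hC
  have hlo := contDiff_loss h hg hC
  -- loss bounds (unweighted)
  have hLu : ∀ i < n, ∀ y : E × E, ‖iteratedFDeriv ℝ i g y‖ ≤ L := fun i hi => norm_iteratedFDeriv_le_of_weight (hL i hi)
  have hTu : ∀ y : E × E, ‖iteratedFDeriv ℝ n g y‖ ≤ T := norm_iteratedFDeriv_le_of_weight hT
  have hyl : ∀ j < n, ‖iteratedFDeriv ℝ j (loss B g) z‖ ≤ kernelMass B * L := fun j hj =>
    norm_iteratedFDeriv_loss_le h hg hC (hLu j hj) z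
  have hyt : ‖iteratedFDeriv ℝ n (loss B g) z‖ ≤ kernelMass B * T := norm_iteratedFDeriv_loss_le h hg hC hTu z
  have hx0 : ‖iteratedFDeriv ℝ 0 (normFactor δ g) z‖ ≤ 1 := by
    rw [norm_iteratedFDeriv_zero, Real.norm_eq_abs, abs_of_pos (normFactor_pos_le_one hδ hg0 z).1]
    exact (normFactor_pos_le_one hδ hg0 z).2
  have key := weight_mul_norm_iteratedFDeriv_mul_le_ends hN hlo (k := 0) (z := z) hΘ0 (by positivity) hx0 hNtop
    (fun i _ hi => hNmid i (by omega)) (y₀ := kernelMass B * L) (yₙ := kernelMass B * T) (Y := kernelMass B * L)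
    (by rw [pow_zero, one_mul]; exact hyl 0 hn) (by rw [pow_zero, one_mul]; exact hyt)
    (fun j _ hj => by rw [pow_zero, one_mul]; exact hyl j hj)
  rw [pow_zero, one_mul] at key
  refine key.trans (le_of_eq ?_)
  rw [← hJd, ← hS, ← hΘ, ← hκ]
  ring

/-- **The level-`n` estimate for the source `Γ = (1 + δ∫g)⁻¹ Q⁺_B(g,g)`**: for `n ≥ 1`,
`k ≥ d + 1` and `L ≥ 0` there are `c₁, c₂ ≥ 0` (depending on `n, k, δ, ‖B‖₁, J_d, L` only) such
that for every nonnegative Schwartz-type slice with `(1 + ‖y‖)ᵏ ‖Dⁱg(y)‖ ≤ L` (`i < n`) and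
`(1 + ‖y‖)ᵏ ‖Dⁿg(y)‖ ≤ T`: `(1 + ‖z‖)ᵏ ‖DⁿΓ(z)‖ ≤ c₁ T + c₂` for all `z` — affine in the top
order, with no loss of weight (CIP 1994 p. 146). [cite: CIPDiluteGases1994, §5.3 Lemma 5.3.6 (p. 146)] -/
theorem source_level_bound (h : KernelHyp B M R) (hδ : 0 ≤ δ) {n : ℕ} (hn : 1 ≤ n) {k : ℕ}
    (hk : Module.finrank ℝ E + 1 ≤ k) {L : ℝ} (hL0 : 0 ≤ L) :
    ∃ c₁ c₂ : ℝ, 0 ≤ c₁ ∧ 0 ≤ c₂ ∧ ∀ (g : E × E → ℝ) (C : ℕ → ℕ → ℝ) (T : ℝ),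
      ContDiff ℝ ∞ g → (∀ z, 0 ≤ g z) →
      (∀ (m k' : ℕ) (z : E × E), (1 + ‖z‖) ^ k' * ‖iteratedFDeriv ℝ m g z‖ ≤ C m k') →
      (∀ i < n, ∀ y : E × E, (1 + ‖y‖) ^ k * ‖iteratedFDeriv ℝ i g y‖ ≤ L) →
      (∀ y : E × E, (1 + ‖y‖) ^ k * ‖iteratedFDeriv ℝ n g y‖ ≤ T) →
      ∀ z, (1 + ‖z‖) ^ k * ‖iteratedFDeriv ℝ n (source δ B g) z‖ ≤ c₁ * T + c₂ := by
  set Jd : ℝ := ∫ w : E, (1 + ‖w‖) ^ (-((Module.finrank ℝ E : ℝ) + 1)) with hJd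
  have hJd0 : 0 ≤ Jd := weightInv_integral_nonneg
  set S : ℝ := max 1 (Jd * L) with hS
  set Θ : ℝ := (4 ^ (n - 1) * max δ 1 * S) ^ (2 ^ (n - 1) - 1) with hΘ
  have hΘ0 : 0 ≤ Θ := by positivity
  set κ : ℝ := 2 ^ (n - 1) * (δ * (2 ^ (n - 1) * Θ * Θ) * S) with hκ
  have hκ0 : 0 ≤ κ := by positivity
  have hKM := h.kernelMass_nonneg
  -- the weighted gain bounds of the lower orders and the top order
  set GaLow : ℝ := kernelMass B * (2 ^ (k + 1) * (2 * L * L + 2 ^ n * L * L)) with hGaLow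
  have hGaLow0 : 0 ≤ GaLow := by positivity
  refine ⟨kernelMass B * (2 ^ (k + 1) * (2 * L)) + δ * Jd * GaLow,
    kernelMass B * (2 ^ (k + 1) * (2 ^ n * L * L)) + κ * GaLow + 2 ^ n * Θ * GaLow,
    by positivity, by positivity, ?_⟩
  intro g C T hg hg0 hC hL hT z
  have hT0 : 0 ≤ T := le_trans (by positivity) (hT 0)
  obtain ⟨hNmid, hNtop⟩ := normFactor_level_bound hδ hg hg0 hC hn hk hL hT z
  have hN := contDiff_normFactor hδ hg hg0 hC
  have hGa := contDiff_gain h hg hC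
  -- gain bounds
  have hy0 : (1 + ‖z‖) ^ k * ‖iteratedFDeriv ℝ 0 (gain B g) z‖ ≤ GaLow := by
    rw [norm_iteratedFDeriv_zero, Real.norm_eq_abs]
    have h0 : ∀ y : E × E, (1 + ‖y‖) ^ k * |g y| ≤ L := fun y => by
      have := hL 0 hn y; rwa [norm_iteratedFDeriv_zero, Real.norm_eq_abs] at this
    have h0' : ∀ y : E × E, |g y| ≤ L := fun y =>
      le_trans (by simpa using (mul_le_mul_of_nonneg_right (one_le_pow₀ (le_add_of_nonneg_right (norm_nonneg y)) :
        (1:ℝ) ≤ (1 + ‖y‖) ^ k) (abs_nonneg (g y)))) (h0 y)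
    refine (weight_mul_abs_gain_le h h0 h0' z).trans ?_
    rw [hGaLow]
    refine mul_le_mul_of_nonneg_left ?_ hKM
    have h12 : (1:ℝ) ≤ 2 + 2 ^ n := by linarith [pow_nonneg (zero_le_two (α := ℝ)) n]
    calc (2:ℝ) ^ (k + 1) * L * L = 2 ^ (k + 1) * (L * L) * 1 := by ring
      _ ≤ 2 ^ (k + 1) * (L * L) * (2 + 2 ^ n) := mul_le_mul_of_nonneg_left h12 (by positivity)
      _ = 2 ^ (k + 1) * (2 * L * L + 2 ^ n * L * L) := by ring
  have hym : ∀ j, 1 ≤ j → j < n → (1 + ‖z‖) ^ k * ‖iteratedFDeriv ℝ j (gain B g) z‖ ≤ GaLow := by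
    intro j h1 hj
    refine (weight_mul_norm_iteratedFDeriv_gain_le h hg hC h1 (fun i hi y => hL i (hi.trans hj) y)
      (hL j hj) z).trans ?_
    rw [hGaLow]
    refine mul_le_mul_of_nonneg_left (mul_le_mul_of_nonneg_left ?_ (by positivity)) hKM
    nlinarith [pow_le_pow_right₀ (by norm_num : (1:ℝ) ≤ 2) hj.le, mul_nonneg hL0 hL0]
  have hyn : (1 + ‖z‖) ^ k * ‖iteratedFDeriv ℝ n (gain B g) z‖ ≤
      kernelMass B * (2 ^ (k + 1) * (2 * L * T + 2 ^ n * L * L)) :=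
    weight_mul_norm_iteratedFDeriv_gain_le h hg hC hn hL hT z
  have hx0 : ‖iteratedFDeriv ℝ 0 (normFactor δ g) z‖ ≤ 1 := by
    rw [norm_iteratedFDeriv_zero, Real.norm_eq_abs, abs_of_pos (normFactor_pos_le_one hδ hg0 z).1]
    exact (normFactor_pos_le_one hδ hg0 z).2
  have key := weight_mul_norm_iteratedFDeriv_mul_le_ends hN hGa (k := k) (z := z) hΘ0 hGaLow0 hx0 hNtop
    (fun i _ hi => hNmid i (by omega)) hy0 hyn hym
  refine key.trans (le_of_eq ?_)
  rw [← hJd, ← hS, ← hΘ, ← hκ]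
  ring

/-- **All weighted derivatives of the source of a nonnegative Schwartz-type slice are bounded.**
[folklore] -/
theorem source_bounds_all (h : KernelHyp B M R) (hδ : 0 ≤ δ) (hg : ContDiff ℝ ∞ g) (hg0 : ∀ z, 0 ≤ g z)
    (hC : ∀ (n k : ℕ) (z : E × E), (1 + ‖z‖) ^ k * ‖iteratedFDeriv ℝ n g z‖ ≤ C n k) (n k : ℕ) :
    ∃ C' : ℝ, ∀ z : E × E, (1 + ‖z‖) ^ k * ‖iteratedFDeriv ℝ n (source δ B g) z‖ ≤ C' := by
  -- reduce to a weight `k' ≥ max k (d+1)`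
  set k' : ℕ := max k (Module.finrank ℝ E + 1) with hk'
  suffices H : ∃ C' : ℝ, ∀ z : E × E, (1 + ‖z‖) ^ k' * ‖iteratedFDeriv ℝ n (source δ B g) z‖ ≤ C' by
    obtain ⟨C', hC'⟩ := H
    exact ⟨C', fun z => weight_mono (g := source δ B g) (le_max_left _ _) hC' z⟩
  have hk'd : Module.finrank ℝ E + 1 ≤ k' := le_max_right _ _
  rcases Nat.eq_zero_or_pos n with hn | hn
  · subst hn
    refine ⟨kernelMass B * (2 ^ (k' + 1) * C 0 k' * C 0 0), fun z => ?_⟩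
    rw [norm_iteratedFDeriv_zero, Real.norm_of_nonneg (source_nonneg h hδ hg0 z)]
    exact weight_mul_source_le h hδ hg0 (fun y => by
      have := hC 0 k' y; rwa [norm_iteratedFDeriv_zero, Real.norm_eq_abs] at this) (abs_le_of_bounds hC) z
  · set L : ℝ := ∑ i ∈ Finset.range n, C i k' with hL
    have hL0 : 0 ≤ L := Finset.sum_nonneg fun i _ => bound_nonneg hC i k'
    have hLi : ∀ i < n, ∀ y : E × E, (1 + ‖y‖) ^ k' * ‖iteratedFDeriv ℝ i g y‖ ≤ L := fun i hi y =>
      (hC i k' y).trans (Finset.single_le_sum (f := fun i => C i k') (fun i _ => bound_nonneg hC i k')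
        (Finset.mem_range.2 hi))
    obtain ⟨c₁, c₂, -, -, hc⟩ := source_level_bound h hδ hn hk'd hL0
    exact ⟨c₁ * C n k' + c₂, hc g C (C n k') hg hg0 hC hLi (fun y => hC n k' y)⟩

/-- **All derivatives of the absorption of a nonnegative Schwartz-type slice are bounded.** [folklore] -/
theorem absorption_bounds_all (h : KernelHyp B M R) (hδ : 0 ≤ δ) (hg : ContDiff ℝ ∞ g)
    (hg0 : ∀ z, 0 ≤ g z)
    (hC : ∀ (n k : ℕ) (z : E × E), (1 + ‖z‖) ^ k * ‖iteratedFDeriv ℝ n g z‖ ≤ C n k) (n : ℕ) :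
    ∃ C' : ℝ, ∀ z : E × E, ‖iteratedFDeriv ℝ n (absorption δ B g) z‖ ≤ C' := by
  set k' : ℕ := Module.finrank ℝ E + 1 with hk'
  rcases Nat.eq_zero_or_pos n with hn | hn
  · subst hn
    refine ⟨kernelMass B * C 0 0, fun z => ?_⟩
    rw [norm_iteratedFDeriv_zero, Real.norm_of_nonneg (absorption_nonneg_le h hδ hg.continuous hg0 (abs_le_of_bounds hC) z).1]
    exact (absorption_nonneg_le h hδ hg.continuous hg0 (abs_le_of_bounds hC) z).2
  · set L : ℝ := ∑ i ∈ Finset.range n, C i k' with hL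
    have hL0 : 0 ≤ L := Finset.sum_nonneg fun i _ => bound_nonneg hC i k'
    have hLi : ∀ i < n, ∀ y : E × E, (1 + ‖y‖) ^ k' * ‖iteratedFDeriv ℝ i g y‖ ≤ L := fun i hi y =>
      (hC i k' y).trans (Finset.single_le_sum (f := fun i => C i k') (fun i _ => bound_nonneg hC i k')
        (Finset.mem_range.2 hi))
    obtain ⟨c₁, c₂, -, -, hc⟩ := absorption_level_bound h hδ hn (le_refl k') hL0
    exact ⟨c₁ * C n k' + c₂, hc g C (C n k') hg hg0 hC hLi (fun y => hC n k' y)⟩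

end TruncPicard

end Literature.MathematicalPhysics.KineticTheory
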